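import Mathlib
import HarnessLib
import Literature.Probability.LatticeModels.IsingThermodynamics
import Summits.CriticalPhenomena.Ising3DConformalLimit.Theorems.PrecisionLaplacianDirectCorrelationStableTailScaleRegularityAux
import Summits.CriticalPhenomena.Ising3DConformalLimit.Theorems.PrecisionLaplacianDirectCorrelationStableTailScaleRegularityAux2
import Summits.CriticalPhenomena.Ising3DConformalLimit.Theorems.PrecisionLaplacianDirectCorrelationStableTailScaleRegularityAux3
import Summits.CriticalPhenomena.Ising3DConformalLimit.Theorems.PrecisionLaplacianDirectCorrelationStableTailScaleRegularityAux4
import Summits.CriticalPhenomena.Ising3DConformalLimit.Theorems.PrecisionLaplacianDirectCorrelationStableTailScaleRegularityAux5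
import Summits.CriticalPhenomena.Ising3DConformalLimit.Theorems.PrecisionLaplacianDirectCorrelationStableTailScaleRegularityAux6

/-!
# Stub `stub_scaleRegularity` of line `self-energy-pick-inversion`
# (crux `PrecisionLaplacian.DirectCorrelationStableTail`, stmt-CriticalPhenomena-4799)

THE LEVER'S PAYOFF in honest generality (no Ising input): for ANY `a : ℤ³ → ℝ`, nonnegative off the
origin and invariant under coordinate sign flips (the coordinate-permutation half of the hyperoctahedral
hypothesis is not even used), whose transverse slab modes `â⁽ⁱ⁾_n(k) = Σ'_y a(insertNth i n y) cos(k·y)`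
are Hausdorff moment sequences from `n = 1` (Haus), obey a linear transverse gap
`â_{n+1}(k) ≤ e^{-c₀‖k‖} â_n(k)` on `[-π,π]²` (Gap), and whose slab sums satisfy `S⁽ⁱ⁾(n) n^{3-η} → c > 0`
(Rad, `0 < η < 1`), the rescaled function `a(x)|x|₂^{5-η}` is (R1) bounded, (R2) asymptotically
equicontinuous at its own scale, (R3) slab-tight.

Proof (all analysis is in the six helper files `…ScaleRegularityAux*.lean`):
* JUNK TRICK: Rad with `c > 0` and the monotonicity of the Hausdorff moments `S(n) = ∫ t^{n-1}dτ₀` force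
  `S(n) > 0`, hence SUMMABILITY of every slab profile `n ≥ 1` (`family_summable`); sign flips make the
  profiles even, so Fourier inversion on `ℤ²` applies (`…Aux`).
* GAP MOMENT BOUND (`…Aux3`): `â_{m+d}(k) ≤ S(m) e^{-c₀ d‖k‖}` and `∫_Q e^{-b‖k‖} ≤ 16/b²`,
  `∫_Q ‖k‖e^{-b‖k‖} ≤ 128/b³` give, with `m ≈ n/2`, the RATES (`…Aux5`)
  `a ≤ C₀ n^{-(5-η)}`, `|a(n,y) − a(n,y')| ≤ C₁ |y−y'|₁ n^{-(6-η)}`,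
  `|a(n,y) − a(n+1,y)| ≤ C₂ n^{-(6-η)}` (the last one from `â_n − â_{n+1} = ∫ t^{n-1}(1-t)dτ ≥ 0` and the
  moment difference bound of `…Aux2`).
* The three clauses then follow from the rates alone (`…Aux6`): (R1) in the frame of the largest
  coordinate `|x_i| = n ≥ |x|₂/√3`, `a(x) = a(insertNth i n ·) ≤ C₀ n^{-(5-η)}` (small `x` form a finite
  set); (R2) chain the transverse and longitudinal rates inside the frame of `x`; (R3) a transverse point
  `y` with `‖y‖∞ = m > Kn` lies in the slab `m` of a transverse direction, so `a ≤ C₀ m^{-(5-η)}`, the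
  shell `‖y‖∞ = m` has `8m` points, the tail `Σ_{m>Kn} m^{-(4-η)}` is `O((Kn)^{-(3-η)})`, and
  `S(n) ≥ (c/2) n^{-(3-η)}`.

Sources: planner card of the line (stub 4 docstring); Berg–Christensen–Ressel 1984 ch. 3 §1 (positive
definite functions), Bingham–Goldie–Teugels 1987 §1.7; Widder 1941 ch. III (Hausdorff moments).
-/

noncomputable section

namespace Summit.CriticalPhenomena.Ising3DConformalLimit.Cruxes.DirectCorrelationStableTail.SelfEnergyPickInversion

open MeasureTheory Filter Topology Real
open scoped BigOperators
open Literature.Probability.LatticeModels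

/-! ### The registered stub -/

/-- **Registered stub `stub_scaleRegularity`** (signature EXACTLY as registered on stmt-CriticalPhenomena-4799; package form:
`∀ (a : Site 3 → ℝ) (η c : ℝ), (∀ x, x ≠ 0 → 0 ≤ a x) → IsHyperoctahedralInvariant a → IsSlabHausdorff a → HasTransverseGap a → 0 < η → η < 1 → 0 < c → HasRadialAsymptotics a η c → IsRegularAtScale a η`).
Haus + Gap + Rad ⇒ (R1) boundedness, (R2) asymptotic equicontinuity at scale, (R3) slab tightness of
`a(x)|x|₂^{5-η}`, via summability forced by Rad, Fourier inversion on `ℤ²`, the gap moment bound and the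
three rates; see the module docstring for the proof and the helper files for the analysis. -/
theorem stub_scaleRegularity :
    ∀ (a : Site 3 → ℝ) (η c : ℝ), (∀ x : Site 3, x ≠ 0 → 0 ≤ a x) →
    ((∀ (σ : Equiv.Perm (Fin 3)) (x : Site 3), a (fun j => x (σ j)) = a x) ∧ ∀ (j : Fin 3) (x : Site 3), a
      (Function.update x j (-x j)) = a x) →
    (∀ (i : Fin 3) (k : Fin 2 → ℝ), ∃ τ : MeasureTheory.Measure ℝ, MeasureTheory.IsFiniteMeasure τ ∧ τ
      (Set.Icc (0 : ℝ) 1)ᶜ = 0 ∧ ∀ n : ℕ, 1 ≤ n → (∑' y : Fin 2 → ℤ, a (Fin.insertNth i (n : ℤ) (y) : Site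
      3) * Real.cos (∑ j, k j * (y j : ℝ))) = ∫ t, t ^ (n - 1) ∂τ) →
    (∃ c : ℝ, 0 < c ∧ ∀ (i : Fin 3) (k : Fin 2 → ℝ), (∀ j, |k j| ≤ Real.pi) → ∀ n : ℕ, 1 ≤ n → (∑' y : Fin
      2 → ℤ, a (Fin.insertNth i ((n + 1 : ℕ) : ℤ) (y) : Site 3) * Real.cos (∑ j, k j * (y j : ℝ))) ≤
      Real.exp (-(c * ‖k‖)) * (∑' y : Fin 2 → ℤ, a (Fin.insertNth i (n : ℤ) (y) : Site 3) * Real.cos (∑ j,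
      k j * (y j : ℝ)))) →
    0 < η → η < 1 → 0 < c →
    (∀ i : Fin 3, Filter.Tendsto (fun n : ℕ => (∑' y : Fin 2 → ℤ, a (Fin.insertNth i (n : ℤ) (y) : Site 3))
      * (n : ℝ) ^ (3 - η)) Filter.atTop (nhds c)) →
    ((∃ C : ℝ, ∀ x : Site 3, x ≠ 0 → a x * Real.sqrt (∑ j, ((x) j : ℝ) ^ 2) ^ (5 - η) ≤ C) ∧ (∀ ε : ℝ, 0 <
      ε → ∃ δ : ℝ, 0 < δ ∧ ∃ R₀ : ℝ, ∀ x y : Site 3, R₀ ≤ Real.sqrt (∑ j, ((x) j : ℝ) ^ 2) → Real.sqrt (∑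
      j, ((x - y) j : ℝ) ^ 2) ≤ δ * Real.sqrt (∑ j, ((x) j : ℝ) ^ 2) → |a x * Real.sqrt (∑ j, ((x) j : ℝ) ^
      2) ^ (5 - η) - a y * Real.sqrt (∑ j, ((y) j : ℝ) ^ 2) ^ (5 - η)| ≤ ε) ∧ (∀ ε : ℝ, 0 < ε → ∃ K : ℝ, 0
      < K ∧ ∃ N₀ : ℕ, ∀ (i : Fin 3) (n : ℕ), N₀ ≤ n → (∑' y : Fin 2 → ℤ, if K * (n : ℝ) < ‖y‖ then a
      (Fin.insertNth i (n : ℤ) (y) : Site 3) else 0) ≤ ε * (∑' y : Fin 2 → ℤ, a (Fin.insertNth i (n : ℤ)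
      (y) : Site 3)))) := by
  intro a η c hpos hinv hHaus hGap hη0 hη1 hc hRad
  obtain ⟨c₀, hc₀, hGap⟩ := hGap
  have hflip := hinv.2
  have hP : (0 : ℝ) ≤ 1 / (2 * π) ^ 2 := by positivity
  /- Step 0: two-sided radial bounds, uniformly in the direction. -/
  obtain ⟨N₁, hN₁⟩ := eventually_two_sided_fin3
    (u := fun (i : Fin 3) (n : ℕ) => (∑' y : Fin 2 → ℤ, a (Fin.insertNth i (n : ℤ) y)) * (n : ℝ) ^ (3 - η))
    hc hRad
  /- Step 1: the abstract family hypotheses, direction by direction. -/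
  have hnn : ∀ (i : Fin 3) (n : ℕ), 1 ≤ n → ∀ y : Fin 2 → ℤ, 0 ≤ a (Fin.insertNth i (n : ℤ) y) :=
    fun i n hn y => hpos _ (insertNth_ne_zero i (by exact_mod_cast (show n ≠ 0 by omega)) y)
  have heven : ∀ (i : Fin 3) (n : ℕ), 1 ≤ n → ∀ y : Fin 2 → ℤ,
      a (Fin.insertNth i (n : ℤ) (-y)) = a (Fin.insertNth i (n : ℤ) y) :=
    fun i n _ y => slab_profile_even hflip i n y
  have hsum : ∀ (i : Fin 3) (n : ℕ), 1 ≤ n → Summable (fun y : Fin 2 → ℤ => a (Fin.insertNth i (n : ℤ) y)) :=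
    fun i n hn => family_summable (Φ := fun (n : ℕ) (y : Fin 2 → ℤ) => a (Fin.insertNth i (n : ℤ) y))
      (hHaus i) hc (fun n hn => (hN₁ i n hn).1) hn
  have hS0 : ∀ (i : Fin 3) (m : ℕ), 1 ≤ m → 0 ≤ ∑' z : Fin 2 → ℤ, a (Fin.insertNth i (m : ℤ) z) :=
    fun i m hm => tsum_nonneg (hnn i m hm)
  have hup : ∀ (i : Fin 3) (m : ℕ), N₁ ≤ m → 1 ≤ m →
      (∑' z : Fin 2 → ℤ, a (Fin.insertNth i (m : ℤ) z)) * (m : ℝ) ^ (3 - η) ≤ 2 * c :=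
    fun i m hmN _ => (hN₁ i m hmN).2
  /- Step 2: the three gap moment bounds (F0), (F1), (F2). -/
  have hA : ∀ d : ℕ, (16 : ℝ) / (c₀ * d) ^ 2 = 16 / c₀ ^ 2 / (d : ℝ) ^ 2 := fun d => by
    rw [mul_pow, div_div]
  have hA' : ∀ d : ℕ, (128 : ℝ) / (c₀ * d) ^ 3 = 128 / c₀ ^ 3 / (d : ℝ) ^ 3 := fun d => by
    rw [mul_pow, div_div]
  have hF0 : ∀ (i : Fin 3) (m d : ℕ), 1 ≤ m → 1 ≤ d → ∀ y : Fin 2 → ℤ,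
      |a (Fin.insertNth i ((m + d : ℕ) : ℤ) y)| ≤ 1 / (2 * π) ^ 2 *
        ((∑' z : Fin 2 → ℤ, a (Fin.insertNth i (m : ℤ) z)) * (16 / c₀ ^ 2 / (d : ℝ) ^ 2)) := by
    intro i m d hm hd y
    have h := family_abs_le (Φ := fun (n : ℕ) (y : Fin 2 → ℤ) => a (Fin.insertNth i (n : ℤ) y)) hc₀
      (hsum i) (heven i) (hnn i) (hHaus i) (hGap i) hm hd y
    rwa [hA d] at h
  have hF1 : ∀ (i : Fin 3) (m d : ℕ), 1 ≤ m → 1 ≤ d → ∀ y y' : Fin 2 → ℤ,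
      |a (Fin.insertNth i ((m + d : ℕ) : ℤ) y) - a (Fin.insertNth i ((m + d : ℕ) : ℤ) y')|
        ≤ (∑ j, |(y j : ℝ) - y' j|) * (1 / (2 * π) ^ 2 *
          ((∑' z : Fin 2 → ℤ, a (Fin.insertNth i (m : ℤ) z)) * (128 / c₀ ^ 3 / (d : ℝ) ^ 3))) := by
    intro i m d hm hd y y'
    have h := family_abs_sub_le (Φ := fun (n : ℕ) (y : Fin 2 → ℤ) => a (Fin.insertNth i (n : ℤ) y)) hc₀
      (hsum i) (heven i) (hnn i) (hHaus i) (hGap i) hm hd y y'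
    rwa [hA' d] at h
  have hF2 : ∀ (i : Fin 3) (m d u : ℕ), 1 ≤ m → 1 ≤ d → ∀ y : Fin 2 → ℤ,
      |a (Fin.insertNth i ((m + d + u : ℕ) : ℤ) y) - a (Fin.insertNth i ((m + d + u + 1 : ℕ) : ℤ) y)|
        ≤ 1 / (2 * π) ^ 2 * ((∑' z : Fin 2 → ℤ, a (Fin.insertNth i (m : ℤ) z)) / (u + 1) *
          (16 / c₀ ^ 2 / (d : ℝ) ^ 2)) := by
    intro i m d u hm hd y
    have h := family_abs_sub_succ_le (Φ := fun (n : ℕ) (y : Fin 2 → ℤ) => a (Fin.insertNth i (n : ℤ) y))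
      hc₀ (hsum i) (heven i) (hnn i) (hHaus i) (hGap i) hm hd u y
    rwa [hA d] at h
  /- Step 3: the three rates. -/
  have hη3 : (0 : ℝ) ≤ 3 - η := by linarith
  have hη3' : 3 - η ≤ (3 : ℝ) := by linarith
  have hR0 : ∀ (i : Fin 3) (n : ℕ), 2 * N₁ + 2 ≤ n → ∀ y : Fin 2 → ℤ,
      |a (Fin.insertNth i (n : ℤ) y)| * (n : ℝ) ^ (5 - η)
        ≤ 108 * (1 / (2 * π) ^ 2) * (16 / c₀ ^ 2) * (2 * c) := by
    intro i n hn y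
    have h := rate_axial (Φ := fun (n : ℕ) (y : Fin 2 → ℤ) => a (Fin.insertNth i (n : ℤ) y))
      (S := fun m : ℕ => ∑' z : Fin 2 → ℤ, a (Fin.insertNth i (m : ℤ) z)) hP (by positivity) hη3 hη3'
      (hS0 i) (hup i) (hF0 i) hn y
    rwa [show (3 - η) + 2 = 5 - η by ring] at h
  have hR1 : ∀ (i : Fin 3) (n : ℕ), 2 * N₁ + 2 ≤ n → ∀ y y' : Fin 2 → ℤ,
      |a (Fin.insertNth i (n : ℤ) y) - a (Fin.insertNth i (n : ℤ) y')| * (n : ℝ) ^ (6 - η)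
        ≤ 216 * (1 / (2 * π) ^ 2) * (128 / c₀ ^ 3) * (2 * c) * (∑ j, |(y j : ℝ) - y' j|) := by
    intro i n hn y y'
    have h := rate_transverse (Φ := fun (n : ℕ) (y : Fin 2 → ℤ) => a (Fin.insertNth i (n : ℤ) y))
      (S := fun m : ℕ => ∑' z : Fin 2 → ℤ, a (Fin.insertNth i (m : ℤ) z))
      (D := fun y y' : Fin 2 → ℤ => ∑ j, |(y j : ℝ) - y' j|) hP (by positivity) hη3 hη3'
      (hS0 i) (fun y y' => Finset.sum_nonneg fun _ _ => abs_nonneg _) (hup i) (hF1 i) hn y y'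
    rwa [show (3 - η) + 3 = 6 - η by ring] at h
  have hR2 : ∀ (i : Fin 3) (n : ℕ), 2 * N₁ + 4 ≤ n → ∀ y : Fin 2 → ℤ,
      |a (Fin.insertNth i (n : ℤ) y) - a (Fin.insertNth i ((n + 1 : ℕ) : ℤ) y)| * (n : ℝ) ^ (6 - η)
        ≤ 2048 * (1 / (2 * π) ^ 2) * (16 / c₀ ^ 2) * (2 * c) := by
    intro i n hn y
    have h := rate_longitudinal (Φ := fun (n : ℕ) (y : Fin 2 → ℤ) => a (Fin.insertNth i (n : ℤ) y))
      (S := fun m : ℕ => ∑' z : Fin 2 → ℤ, a (Fin.insertNth i (m : ℤ) z)) hP (by positivity) hη3 hη3'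
      (hS0 i) (hup i) (hF2 i) hn y
    rwa [show (3 - η) + 3 = 6 - η by ring] at h
  have hC₀0 : (0 : ℝ) ≤ 108 * (1 / (2 * π) ^ 2) * (16 / c₀ ^ 2) * (2 * c) := by positivity
  have hC₁0 : (0 : ℝ) ≤ 216 * (1 / (2 * π) ^ 2) * (128 / c₀ ^ 3) * (2 * c) := by positivity
  have hC₂0 : (0 : ℝ) ≤ 2048 * (1 / (2 * π) ^ 2) * (16 / c₀ ^ 2) * (2 * c) := by positivity
  /- Step 4: the three clauses. -/
  exact ⟨regular_bounded hpos hflip hη0 hη1 hR0,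
    regular_equicontinuous hflip hη0 hη1 hC₀0 hC₁0 hC₂0 hnn hR0 hR1 hR2,
    regular_tight hflip hη0 hη1 hc hnn (fun i n hn => (hN₁ i n hn).1) hR0⟩

end Summit.CriticalPhenomena.Ising3DConformalLimit.Cruxes.DirectCorrelationStableTail.SelfEnergyPickInversion

end
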